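import Mathlib.Analysis.SpecialFunctions.Exponential
import Mathlib.Analysis.SpecialFunctions.Complex.Log
import Mathlib.MeasureTheory.Measure.Lebesgue.Basic
import HarnessLib

/-!
# The Turán–Nazarov inequality (Turán's lemma for exponential polynomials on a measurable set)

One NAMED FACT (D-0014: `def … : Prop`, nothing proved): F. L. Nazarov, *Local estimates for
exponential polynomials and their applications to inequalities of the uncertainty principle type*,
Algebra i Analiz 5:4 (1993) 3–66 = St. Petersburg Math. J. 5 (1994) 663–717 [Nazarov1993LocalEstimates],
in the form printed (and attributed to Nazarov) as Theorem 1.1 of O. Friedland, Y. Yomdin, *An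
observation on the Turán–Nazarov inequality*, arXiv:1107.0039 = Studia Math. 218 (2013)
[FriedlandYomdin2011TuranNazarov] — the statement READ for this file:

"**Theorem 1.1** ([Nazarov]). Let `p(t) = ∑_{k=0}^{m} c_k e^{λ_k t}` be an exponential polynomial,
where `c_k, λ_k ∈ ℂ`. Let `B ⊂ ℝ` be an interval, and let `Ω ⊂ B` be a measurable set. Then
`sup_B |p| ≤ e^{μ₁(B)·max|Re λ_k|} · (c μ₁(B)/μ₁(Ω))^m · sup_Ω |p|`, where `c > 0` is an absolute
constant."  (Turán 1953 had `Ω` a subinterval; Nazarov allows any `Ω` of positive measure.)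

Typing.  `B = [a, b]` with `a < b` (`μ₁(B) = b - a`); `Ω ⊆ [a, b]` measurable with `volume Ω ≠ 0`
(then `0 < μ₁(Ω) ≤ b - a < ∞` and `μ₁(Ω) = (volume Ω).toReal`).  "`sup_B |p| ≤ K · sup_Ω |p|`" is
written pointwise: for every `S` bounding `|p|` on `Ω`, `|p(t)| ≤ K·S` for all `t ∈ B` (equivalent,
and free of `sSup` bookkeeping).  `max_k |Re λ_k|` enters through an arbitrary upper bound `Λ` (the
right-hand side is monotone in it).  The `m + 1` terms are indexed by `Fin (m + 1)`; coincident
exponents are allowed (they only lower the effective degree, and an admissible absolute constant may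
be taken `≥ 1`, so the bound with exponent `m` persists).  KEY FEATURE for applications: for purely
imaginary exponents (`Re λ_k = 0`, e.g. matrix coefficients of a compact group along a one-parameter
subgroup) the bound `(c(b-a)/μ₁(Ω))^m` depends only on the NUMBER of exponentials, not on the
frequencies.

Why here: a Remez / small-ball tool on compact groups for route `QuantumFields/QCD/PauliWegnerSea` —
clause (b′) of `Summit.QuantumFields.QCD.Theses.PauliWegnerSea.TiltedFlatness` (stmt-QuantumFields-14070)
needs a sublevel-set estimate, uniform over a fixed finite-dimensional space of link polynomials on
`SU(3)^16` with Haar measure; along every one-parameter subgroup such a polynomial is an exponential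
polynomial with purely imaginary exponents and a number of terms bounded by the degree alone, which is
exactly the regime of this lemma (the convex-body / Lebesgue analogues `CarberyWright.supSublevelBound`,
`CarberyWright.supLeGeometricMean` are already in `Literature/Analysis/Approximation/CarberyWright.lean`).
It is a hypothesis a prover takes as `(h : TuranNazarov.lemma)`, not the item itself.

Deliberately NOT here: Nazarov's sharper forms (the value of `c`, the version with the "(m-1)"
exponent refinements), the Friedland–Yomdin metric-span strengthening (their Thm 1.2), and Brudnyi's
multidimensional quasipolynomial version (J. Approx. Theory 112 (2001) Thm 1.7 = Friedland–Yomdin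
Thm 3.1), whose exponent depends on the exponential type of `p`.
-/

open MeasureTheory

namespace Literature.Analysis.Approximation

/-- **Turán–Nazarov inequality** (Nazarov 1993; as printed in Friedland–Yomdin, Thm 1.1).  There is
an absolute constant `c > 0` such that for every `m`, all coefficients `c₀,…,c_m ∈ ℂ` and exponents
`λ₀,…,λ_m ∈ ℂ`, every interval `[a, b]` (`a < b`), every measurable `Ω ⊆ [a, b]` of positive Lebesgue
measure and every `Λ ≥ max_k |Re λ_k|`: if `|∑_k c_k e^{λ_k s}| ≤ S` for all `s ∈ Ω`, then
`|∑_k c_k e^{λ_k t}| ≤ e^{(b-a)Λ} · (c (b-a) / μ₁(Ω))^m · S` for all `t ∈ [a, b]`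
— i.e. `sup_{[a,b]} |p| ≤ e^{μ₁(B) max|Re λ_k|} (c μ₁(B)/μ₁(Ω))^m sup_Ω |p|`.
Fact for `PauliWegnerSea.TiltedFlatness` (a hypothesis, not the item). [cite: FriedlandYomdin2011TuranNazarov, Thm 1.1] [cite: Nazarov1993LocalEstimates, Turán's lemma (primary source; statement read in the secondary source FriedlandYomdin2011TuranNazarov, Thm 1.1)] -/
def TuranNazarov.lemma : Prop :=
  ∃ c : ℝ, 0 < c ∧
    ∀ (m : ℕ) (coef expo : Fin (m + 1) → ℂ) (a b : ℝ), a < b →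
    ∀ (Ω : Set ℝ), MeasurableSet Ω → Ω ⊆ Set.Icc a b → volume Ω ≠ 0 →
    ∀ (Λ : ℝ), (∀ k, |(expo k).re| ≤ Λ) →
    ∀ (S : ℝ), (∀ s ∈ Ω, ‖∑ k, coef k * Complex.exp (expo k * (s : ℂ))‖ ≤ S) →
      ∀ t ∈ Set.Icc a b,
        ‖∑ k, coef k * Complex.exp (expo k * (t : ℂ))‖ ≤
          Real.exp ((b - a) * Λ) * (c * (b - a) / (volume Ω).toReal) ^ m * S

end Literature.Analysis.Approximation
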